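import Literature.NumberTheory.Transcendental.KZFibredRelations
import Literature.NumberTheory.Transcendental.KZDominatedFamily
import Literature.NumberTheory.Transcendental.KZKernelConjectureForms
import Summits.KontsevichZagierPeriods.KontsevichZagierPeriods.Theses.ValuedFieldSpecialisation
import Summits.KontsevichZagierPeriods.KontsevichZagierPeriods.Theorems.ValuedFieldSpecialisationParametricLiftingStrength
import Summits.KontsevichZagierPeriods.KontsevichZagierPeriods.Theorems.ValuedFieldSpecialisationCTConstructionCylinder

/-!
# Route ValuedFieldSpecialisation — crux `ParametricLifting` (stmt-KontsevichZagierPeriods-3498):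
UNDEFORMED NETS GIVE BACK EXACTLY THE SUMMIT

Helper (`--supports`) for item stmt-KontsevichZagierPeriods-3498 (line `registered`, lead c4). The crux
`ParametricLifting` (PL) allows the equal-valued rational pair `(r, r')` to be DEFORMED: the net of the
fibred relation is a `ℤ`-combination of arbitrary DOMINATED families `Rᵢ → r₀ᵢ`, and the
intermediate terms of the fibred chain may diverge as `s → 0⁺`. This file isolates what that freedom
is worth, with no new definition:

* `kontsevichZagierPeriods_iff_parametricLifting_cylinders` — if the net is restricted to
  UNDEFORMED families, i.e. constant families `r₀ᵢ.cylinder = (0,1) × r₀ᵢ`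
  (`KZ.IntegralRep.cylinder`), the resulting statement PL_cyl is EQUIVALENT TO THE SUMMIT:
  (⇐) the empty net; (⇒) a constant family is move-equivalent to its fibre ON THE NOSE
  (`of_cylinder_sub_of_mem_relations`, crux `CTConstruction`'s cylinder file), so a fibred relation
  among constant families is a relation among their fibres
  (`sum_zsmul_of_cylinder_sub_sum_zsmul_of_mem_relations`), whatever the (possibly divergent)
  intermediates of the chain were.
* `parametricLifting_of_parametricLifting_cylinders` — PL_cyl ⇒ PL with the cylinder net itself as
  witness (constant families are dominated, `KZ.IntegralRep.isDominatedFamily_cylinder`), so the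
  chain of implications reads `PL_cyl ⇔ summit ⇒ PL`: the ONLY way in which the crux can be weaker
  than Conjecture 1 is through nets that genuinely deform the pair.
* `parametricLifting_iff_kontsevichZagierPeriods_of_specialFibre`,
  `parametricLifting_iff_kontsevichZagierPeriods_of_ctConstruction` — and under the complement SF
  ("special fibres of dominated fibred relations are relations"), in particular under the route's
  own thesis `CTConstruction`, the crux IS the summit (`PL ⇔ KontsevichZagierPeriods`).

Together with `kontsevichZagierPeriods_iff_parametricLifting_and_specialFibre` (lead c2) and
`parametricLifting_iff_kernelForm` (lead c3) this completes the certified picture used by the line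
chain (`Cruxes/ParametricLifting/LEAD-REPORT-c4.md`): PL is the route's declared open core, parked on
`Literature.NumberTheory.Transcendental.KZKernelConjecture`.

Sources: M. Kontsevich, D. Zagier, *Periods* (2001), §1.2, Conjecture 1 and rules (1)–(3);
A. Huber, S. Müller-Stach, *Periods and Nori Motives* (2017), Conj. 13.2.1. The fibred / dominated /
cylinder vocabulary is this route's (`KZFibredRelations.lean`, `KZDominatedFamily.lean`).
-/

noncomputable section

namespace Summit.KontsevichZagierPeriods.ValuedFieldSpecialisation

open MeasureTheory Set Filter
open scoped Topology
open Literature.NumberTheory.Transcendental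
open Summit.KontsevichZagierPeriods.KontsevichZagierPeriods.Theses.ValuedFieldSpecialisation
  (ParametricLifting CTConstruction)

/-! ### Under SF / `CTConstruction` the crux is the summit -/

/-- **Under SF, `ParametricLifting` ⇔ summit.** If special fibres of dominated fibred relations are
relations (SF — the consequence of `CTConstruction` used by the assembly), then the crux is
equivalent to `KontsevichZagierPeriods`: (⇒) `kontsevichZagierPeriods_of_specialFibre_of_parametricLifting`,
(⇐) `parametricLifting_of_kontsevichZagierPeriods` (empty net).
[Kontsevich–Zagier 2001, §1.2 Conjecture 1] [folklore] -/
theorem parametricLifting_iff_kontsevichZagierPeriods_of_specialFibre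
    (hSF : ∀ (k : ℕ) (d : Fin k → ℕ) (m : Fin k → ℤ) (R : (i : Fin k) → KZ.IntegralRep (d i + 1))
      (r₀ g : (i : Fin k) → KZ.IntegralRep (d i)), (∀ i, KZ.IsDominatedFamily (R i) (r₀ i) (g i)) →
      (∑ i, m i • KZ.of (R i)) ∈ KZ.fibredRelations → (∑ i, m i • KZ.of (r₀ i)) ∈ KZ.relations) :
    ParametricLifting ↔ KontsevichZagierPeriods :=
  ⟨kontsevichZagierPeriods_of_specialFibre_of_parametricLifting hSF,
    parametricLifting_of_kontsevichZagierPeriods⟩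

/-- **Under the route's thesis `CTConstruction`, `ParametricLifting` ⇔ summit**
(`specialFibre_of_ctConstruction`). So, given the thesis-bearing crux, the open core of route
ValuedFieldSpecialisation is literally Conjecture 1. [Kontsevich–Zagier 2001, §1.2 Conjecture 1] [folklore] -/
theorem parametricLifting_iff_kontsevichZagierPeriods_of_ctConstruction (hCT : CTConstruction) :
    ParametricLifting ↔ KontsevichZagierPeriods :=
  parametricLifting_iff_kontsevichZagierPeriods_of_specialFibre (specialFibre_of_ctConstruction hCT)

/-! ### Undeformed (cylinder) nets -/

/-- **A net of constant families is congruent to the net of its fibres**: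
`Σ cᵢ [r₀ᵢ.cylinder] − Σ cᵢ [r₀ᵢ] ∈ KZ.relations`, termwise from
`of_cylinder_sub_of_mem_relations` (`[r.cylinder] − [r] ∈ KZ.relations`).
[Kontsevich–Zagier 2001, §1.2 rules (1)–(3)] [folklore] -/
theorem sum_zsmul_of_cylinder_sub_sum_zsmul_of_mem_relations {k : ℕ} {d : Fin k → ℕ}
    (c : Fin k → ℤ) (r₀ : (i : Fin k) → KZ.IntegralRep (d i)) :
    (∑ i, c i • KZ.of (r₀ i).cylinder) - ∑ i, c i • KZ.of (r₀ i) ∈ KZ.relations := by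
  rw [← Finset.sum_sub_distrib]
  refine sum_mem fun i _ => ?_
  rw [← zsmul_sub]
  exact AddSubgroup.zsmul_mem _ (of_cylinder_sub_of_mem_relations (r₀ i)) (c i)

/-- **PL with undeformed nets ⇒ summit.** Suppose every pair of equal-valued rational representations
`(r, r')` is, modulo `KZ.relations`, the net of fibres `Σ cᵢ [r₀ᵢ]` of a FIBRED relation among the
CONSTANT families `Σ cᵢ [r₀ᵢ.cylinder] ∈ KZ.fibredRelations` (the intermediates of the fibred chain
are unrestricted and may diverge). Then Conjecture 1 holds: fibred relations are relations
(`KZ.fibredRelations_le_relations`) and constant families are move-equivalent to their fibres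
(`sum_zsmul_of_cylinder_sub_sum_zsmul_of_mem_relations`), so `Σ cᵢ [r₀ᵢ] ∈ KZ.relations`, hence
`[r] − [r'] ∈ KZ.relations`. [Kontsevich–Zagier 2001, §1.2 Conjecture 1] [folklore] -/
theorem kontsevichZagierPeriods_of_parametricLifting_cylinders
    (h : ∀ ⦃n m : ℕ⦄ (r : KZ.IntegralRep n) (r' : KZ.IntegralRep m), r.IsRational → r'.IsRational →
      r.value = r'.value → ∃ (k : ℕ) (d : Fin k → ℕ) (c : Fin k → ℤ)
        (r₀ : (i : Fin k) → KZ.IntegralRep (d i)),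
        (∑ i, c i • KZ.of (r₀ i).cylinder) ∈ KZ.fibredRelations ∧
        (∑ i, c i • KZ.of (r₀ i)) - (KZ.of r - KZ.of r') ∈ KZ.relations) :
    KontsevichZagierPeriods := by
  intro n m r r' hr hr' hv
  change KZ.of r - KZ.of r' ∈ KZ.relations
  obtain ⟨k, d, c, r₀, hG, hfib⟩ := h r r' hr hr' hv
  have h2 : (∑ i, c i • KZ.of (r₀ i)) ∈ KZ.relations := by
    have h1 := KZ.relations.sub_mem (KZ.fibredRelations_le_relations hG)
      (sum_zsmul_of_cylinder_sub_sum_zsmul_of_mem_relations c r₀)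
    rwa [sub_sub_cancel] at h1
  have h3 := KZ.relations.sub_mem h2 hfib
  rwa [sub_sub_cancel] at h3

/-- **Summit ⇒ PL with undeformed nets** (the EMPTY net: `k = 0`, `0 ∈ KZ.fibredRelations`, and
`−([r] − [r']) ∈ KZ.relations` is the conjecture for the pair).
[Kontsevich–Zagier 2001, §1.2 Conjecture 1] [folklore] -/
theorem parametricLifting_cylinders_of_kontsevichZagierPeriods (hKZ : KontsevichZagierPeriods) :
    ∀ ⦃n m : ℕ⦄ (r : KZ.IntegralRep n) (r' : KZ.IntegralRep m), r.IsRational → r'.IsRational →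
      r.value = r'.value → ∃ (k : ℕ) (d : Fin k → ℕ) (c : Fin k → ℤ)
        (r₀ : (i : Fin k) → KZ.IntegralRep (d i)),
        (∑ i, c i • KZ.of (r₀ i).cylinder) ∈ KZ.fibredRelations ∧
        (∑ i, c i • KZ.of (r₀ i)) - (KZ.of r - KZ.of r') ∈ KZ.relations := by
  intro n m r r' hr hr' hv
  refine ⟨0, Fin.elim0, Fin.elim0, fun i => i.elim0, ?_, ?_⟩
  · simp only [Finset.univ_eq_empty, Finset.sum_empty]
    exact KZ.fibredRelations.zero_mem
  · simp only [Finset.univ_eq_empty, Finset.sum_empty, zero_sub]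
    exact KZ.relations.neg_mem (hKZ r r' hr hr' hv)

/-- **Summit ⇔ PL with undeformed (cylinder) nets.** Restricting the net of the crux
`ParametricLifting` to CONSTANT families `r₀ᵢ.cylinder` — no deformation of the pair, divergent
intermediates still allowed — gives back exactly Conjecture 1. Reading for the line chain: the only
freedom by which `ParametricLifting` can be weaker than the summit is a net that genuinely deforms the
pair (`Rᵢ → r₀ᵢ` dominated but not constant); cf. `parametricLifting_of_parametricLifting_cylinders`.
[Kontsevich–Zagier 2001, §1.2 Conjecture 1] [folklore] -/
theorem kontsevichZagierPeriods_iff_parametricLifting_cylinders :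
    KontsevichZagierPeriods ↔
      ∀ ⦃n m : ℕ⦄ (r : KZ.IntegralRep n) (r' : KZ.IntegralRep m), r.IsRational → r'.IsRational →
        r.value = r'.value → ∃ (k : ℕ) (d : Fin k → ℕ) (c : Fin k → ℤ)
          (r₀ : (i : Fin k) → KZ.IntegralRep (d i)),
          (∑ i, c i • KZ.of (r₀ i).cylinder) ∈ KZ.fibredRelations ∧
          (∑ i, c i • KZ.of (r₀ i)) - (KZ.of r - KZ.of r') ∈ KZ.relations :=
  ⟨parametricLifting_cylinders_of_kontsevichZagierPeriods,
    kontsevichZagierPeriods_of_parametricLifting_cylinders⟩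

/-- **PL with undeformed nets ⇒ `ParametricLifting`, with the cylinder net itself as witness**:
constant families are dominated near `s = 0⁺` by `r₀ᵢ.abs` with special fibre `r₀ᵢ`
(`KZ.IntegralRep.isDominatedFamily_cylinder`), so `G := Σ cᵢ [r₀ᵢ.cylinder]`, `Rᵢ := r₀ᵢ.cylinder`,
`gᵢ := r₀ᵢ.abs` are admissible data for the crux (the inlined clauses of the route declaration are
`KZ.fibredRelations` and `KZ.IsDominatedFamily` verbatim). [Kontsevich–Zagier 2001, §1.2] [folklore] -/
theorem parametricLifting_of_parametricLifting_cylinders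
    (h : ∀ ⦃n m : ℕ⦄ (r : KZ.IntegralRep n) (r' : KZ.IntegralRep m), r.IsRational → r'.IsRational →
      r.value = r'.value → ∃ (k : ℕ) (d : Fin k → ℕ) (c : Fin k → ℤ)
        (r₀ : (i : Fin k) → KZ.IntegralRep (d i)),
        (∑ i, c i • KZ.of (r₀ i).cylinder) ∈ KZ.fibredRelations ∧
        (∑ i, c i • KZ.of (r₀ i)) - (KZ.of r - KZ.of r') ∈ KZ.relations) :
    ParametricLifting := by
  intro n m r r' hr hr' hv
  obtain ⟨k, d, c, r₀, hG, hfib⟩ := h r r' hr hr' hv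
  refine ⟨∑ i, c i • KZ.of (r₀ i).cylinder, hG, k, d, c, fun i => (r₀ i).cylinder, r₀,
    fun i => (r₀ i).abs, fun i => ?_, rfl, hfib⟩
  exact (KZ.isDominatedFamily_iff _ _ _).mp (KZ.IntegralRep.isDominatedFamily_cylinder (r₀ i))

end Summit.KontsevichZagierPeriods.ValuedFieldSpecialisation
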